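import Mathlib
import Literature.Analysis.FluidPDE.WholeSpaceIBP
import Literature.Analysis.FluidPDE.MollifiedField
import Literature.Analysis.FunctionSpaces.SobolevDomain
import HarnessLib

/-!
# Translation-mollified pressure-free weak Euler fields are exact linear subsolutions off a ball

Analysis/FluidPDE support file (tool T1 of the free-space sink completion of the
anomalous-dissipation summit, route PointSink, stub `stub_freeSpaceSinkCompletion`; the
construction is the first rung of the mollifier ladder of De Lellis–Székelyhidi-type
subsolutions around an `L²` self-similar Euler cone).

Setting. `V : E → E` is measurable with `|V|² ∈ L¹_loc(E)` and is a PRESSURE-FREE WEAK STEADY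
EULER FIELD OFF THE ORIGIN: `∫ ⟪V, Dφ·V⟫ = 0` for every smooth divergence-free `φ` compactly
supported in `E ∖ {0}` (`IsTestFunctionOn ⟨{x | x ≠ 0}, isOpen_ne⟩ φ`). `ρ` is a continuous kernel
with `support ρ ⊆ B_δ`. The translation mollifications are `V_ρ = ρ ⋆ V` and the mollified
momentum flux `S_ρ = ρ ⋆ (V ⊗ V)`, `(S_ρ)ᵢⱼ(x) = ∫ ρ(a) Vᵢ(x − a) Vⱼ(x − a) da`.

Results (all proved, no named facts, no definitions):
* `isTestFunctionOn_comp_add_right` — for `‖a‖ ≤ δ`, the translate `φ(· + a)` of a test field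
  supported in `{δ < ‖x‖}` is a test field off the origin;
* `integral_inner_translate_fderiv_apply_eq_zero` — hence each translate `V(· − a)`, `‖a‖ ≤ δ`,
  is pressure-free weak Euler off the ball: `∫ ⟪V(x − a), Dφ(x) V(x − a)⟫ dx = 0`;
* `integral_integral_mul_inner_translate_eq_zero` — **the mollified flux is an exact LINEAR
  subsolution off `B̄_δ`**: `∫ (∫ ρ(a) ⟪V(x − a), Dφ(x) V(x − a)⟫ da) dx = 0` for all smooth
  divergence-free `φ ∈ C_c^∞({δ < ‖x‖})` (Fubini — the integrand is dominated by the convolution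
  integrand `‖Dφ‖_∞ |ρ(a)| (1_{K'} |V|²)(x − a)`, `K' = tsupport φ + B̄_δ` — then the previous item
  for each `a`);
* `posSemidef_covariance` — the covariance matrix of finitely many `L²` random variables under a
  probability measure is positive semidefinite (Jensen), the abstract form of the pointwise sign
  `S_ρ(x) − V_ρ(x) ⊗ V_ρ(x) ⪰ 0` of the defect (De Lellis–Székelyhidi: averages of solutions are
  subsolutions; here translation averages of a weak solution with a point singularity).
The `ℝ³`-coordinate consequences (stress pairing `∫ ∑ᵢⱼ (S_ρ)ᵢⱼ (Dφ eⱼ)ᵢ = 0`, smoothness of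
`V_ρ`, `S_ρ`, `div V_ρ = 0` via the removable point `isWeaklyDivFree_of_puncture`, and the PSD
defect) are in the companion file `MollifiedEulerConeEuclidean`.

What is NOT here (the remaining rungs of the ladder): a pressure for `S_ρ` on the exterior of the
ball (de Rham for smooth fields on `{δ < ‖x‖}`), the gluing of layers with different `δ`
(compactly supported symmetric anti-divergence, tree `MaoOhTao.hasWeakSymmDivInverse_annulus`), and
the `L¹` control of the corrections.

## Mathlib / tree search

Mathlib (this pin): `MeasureTheory.convolution` calculus (`HasCompactSupport.contDiff_convolution_left`,
`HasCompactSupport.convolutionExists_left`, `Integrable.convolution_integrand`), Fubini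
`integral_integral_swap`, Haar invariance `integral_add_right_eq_self`,
`Measure.measurePreserving_sub_left`, `withDensity` integrals, `ProbabilityTheory.covariance`.
Tree: `MollifiedField` (`divergence_convolution_eq_zero`, derivative of mollified fields; reused),
`WeaklyDivFreeRemovablePoint` (reused), `MollifiedWeakEuler`/`EulerReynoldsMollification` (torus,
space–time, bounded fields: different setting, not reusable here), `SelfSimilarEulerConeFlux`
(zero momentum/torque flux of the DSS cone: the compatibility conditions for the next rungs).
No duplicate (searched `translate\|mollif.*Euler\|convolution_integrand`, 2026-08-17).

## References

* C. De Lellis, L. Székelyhidi Jr., *On admissibility criteria for weak solutions of the Euler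
  equations*, Arch. Ration. Mech. Anal. 195 (2010) 225–260, §2 (subsolutions; averages of
  solutions are subsolutions).
* P. Constantin, W. E, E. S. Titi, Comm. Math. Phys. 165 (1994) 207–209 (mollifying a weak Euler
  solution; the commutator/defect `(u ⊗ u)_ε − u_ε ⊗ u_ε`).
-/

noncomputable section

open MeasureTheory Filter Topology Set Metric Function ContinuousLinearMap
open scoped RealInnerProductSpace ContDiff Convolution Pointwise

namespace Literature.Analysis.FluidPDE

namespace MollifiedEulerCone

variable {E : Type*} [NormedAddCommGroup E] [InnerProductSpace ℝ E] [FiniteDimensional ℝ E]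
  [MeasurableSpace E] [BorelSpace E]
variable {F : Type*} [NormedAddCommGroup F] [NormedSpace ℝ F]

/-! ### Translates of test fields supported off a ball -/

omit [InnerProductSpace ℝ E] [FiniteDimensional ℝ E] [MeasurableSpace E] [BorelSpace E]
  [NormedSpace ℝ F] in
/-- The topological support of a translate: `tsupport (φ(· + a)) ⊆ (· + a)⁻¹' tsupport φ`.
[folklore] -/
theorem tsupport_comp_add_right_subset (φ : E → F) (a : E) :
    tsupport (fun z => φ (z + a)) ⊆ (fun z => z + a) ⁻¹' tsupport φ :=
  closure_minimal (fun z hz => subset_closure (by simpa using hz))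
    ((isClosed_tsupport φ).preimage (continuous_id.add continuous_const))

omit [FiniteDimensional ℝ E] [MeasurableSpace E] [BorelSpace E] in
/-- **Small translates of a test field supported off `B̄_δ` are test fields off the origin.** If
`φ ∈ C_c^∞({δ < ‖x‖})` and `‖a‖ ≤ δ`, then `φ(· + a) ∈ C_c^∞(E ∖ {0})`. [folklore] -/
theorem isTestFunctionOn_comp_add_right {δ : ℝ} {φ : E → F}
    (hφ : FunctionSpaces.IsTestFunctionOn
      ⟨{x : E | δ < ‖x‖}, isOpen_lt continuous_const continuous_norm⟩ φ)
    {a : E} (ha : ‖a‖ ≤ δ) :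
    FunctionSpaces.IsTestFunctionOn ⟨{x : E | x ≠ 0}, isOpen_ne⟩ (fun z => φ (z + a)) := by
  refine ⟨hφ.contDiff.comp (contDiff_id.add contDiff_const),
    hφ.hasCompactSupport.comp_homeomorph (Homeomorph.addRight a), ?_⟩
  intro x hx
  change x ≠ 0
  rintro rfl
  have h1 : (0 : E) + a ∈ tsupport φ := tsupport_comp_add_right_subset φ a hx
  have h2 : δ < ‖a‖ := by
    have := hφ.tsupport_subset h1
    simpa using this
  linarith

omit [FiniteDimensional ℝ E] [MeasurableSpace E] [BorelSpace E] in
/-- The divergence of a translate: `div (φ(· + a))(x) = (div φ)(x + a)`. [folklore] -/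
theorem divergence_comp_add_right (φ : E → E) (a x : E) :
    VectorCalculus.divergence (fun z => φ (z + a)) x = VectorCalculus.divergence φ (x + a) := by
  unfold VectorCalculus.divergence
  rw [fderiv_comp_add_right]

/-! ### The pairing of a translated field with a test field off the ball vanishes -/

/-- **Each small translate of a pressure-free weak Euler field off the origin is a pressure-free
weak Euler field off the ball.** If `∫ ⟪V, Dφ·V⟫ = 0` for all smooth divergence-free `φ`
compactly supported in `E ∖ {0}`, then for `‖a‖ ≤ δ` and every smooth divergence-free `φ`
compactly supported in `{δ < ‖x‖}`: `∫ ⟪V(x − a), Dφ(x) V(x − a)⟫ dx = 0` (translate the test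
field instead of `V`: `x ↦ x + a`, Haar invariance). [folklore] -/
theorem integral_inner_translate_fderiv_apply_eq_zero {V : E → E}
    (hEuler : ∀ φ : E → E, FunctionSpaces.IsTestFunctionOn ⟨{x : E | x ≠ 0}, isOpen_ne⟩ φ →
      (∀ x, VectorCalculus.divergence φ x = 0) → ∫ x, ⟪V x, fderiv ℝ φ x (V x)⟫ = 0)
    {δ : ℝ} {φ : E → E}
    (hφ : FunctionSpaces.IsTestFunctionOn
      ⟨{x : E | δ < ‖x‖}, isOpen_lt continuous_const continuous_norm⟩ φ)
    (hdiv : ∀ x, VectorCalculus.divergence φ x = 0) {a : E} (ha : ‖a‖ ≤ δ) :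
    ∫ x, ⟪V (x - a), fderiv ℝ φ x (V (x - a))⟫ = 0 := by
  have h := hEuler _ (isTestFunctionOn_comp_add_right hφ ha)
    (fun x => by rw [divergence_comp_add_right, hdiv])
  simp_rw [fderiv_comp_add_right] at h
  rw [← integral_add_right_eq_self _ a]
  simpa only [add_sub_cancel_right] using h

/-! ### Fubini: the mollified momentum flux pairs to zero with tests off the ball -/

omit [InnerProductSpace ℝ E] [FiniteDimensional ℝ E] [MeasurableSpace E] [BorelSpace E] in
/-- A continuous function supported in a ball has compact support. [folklore] -/
theorem hasCompactSupport_of_support_subset_ball [ProperSpace E] {ρ : E → ℝ}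
    {δ : ℝ} (hρδ : support ρ ⊆ ball (0 : E) δ) : HasCompactSupport ρ :=
  HasCompactSupport.of_support_subset_isCompact (isCompact_closedBall 0 δ)
    (hρδ.trans ball_subset_closedBall)

/-- **The translation-mollified flux of a pressure-free weak Euler field off the origin is an
exact linear subsolution off the ball** (coordinate-free form). Let `V` be measurable with
`|V|² ∈ L¹_loc(E)` and `∫ ⟪V, Dφ·V⟫ = 0` for all smooth divergence-free `φ ∈ C_c^∞(E ∖ {0})`, and
let `ρ` be continuous with `support ρ ⊆ B_δ`. Then for every smooth divergence-free `φ` compactly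
supported in `{δ < ‖x‖}`,
`∫ (∫ ρ(a) ⟪V(x − a), Dφ(x) V(x − a)⟫ da) dx = 0`,
i.e. `∫ S_ρ : ∇φ = 0` for the mollified momentum flux `S_ρ = ρ ⋆ (V ⊗ V)`. Proof: the integrand
is integrable on `E × E` (it is dominated by `‖Dφ‖_∞ |ρ(a)| (1_{K'}|V|²)(x − a)`,
`K' = tsupport φ + B̄_δ`, a convolution integrand of two `L¹` functions), so Fubini applies, and
for each fixed `a` the inner `dx`-integral vanishes by
`integral_inner_translate_fderiv_apply_eq_zero` (if `ρ(a) ≠ 0` then `‖a‖ < δ`). [folklore] -/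
theorem integral_integral_mul_inner_translate_eq_zero {V : E → E}
    (hVm : AEStronglyMeasurable V volume)
    (hV2 : LocallyIntegrable (fun x => ‖V x‖ ^ 2) volume)
    (hEuler : ∀ φ : E → E, FunctionSpaces.IsTestFunctionOn ⟨{x : E | x ≠ 0}, isOpen_ne⟩ φ →
      (∀ x, VectorCalculus.divergence φ x = 0) → ∫ x, ⟪V x, fderiv ℝ φ x (V x)⟫ = 0)
    {ρ : E → ℝ} (hρ : Continuous ρ) {δ : ℝ} (hρδ : support ρ ⊆ ball (0 : E) δ)
    {φ : E → E}
    (hφ : FunctionSpaces.IsTestFunctionOn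
      ⟨{x : E | δ < ‖x‖}, isOpen_lt continuous_const continuous_norm⟩ φ)
    (hdiv : ∀ x, VectorCalculus.divergence φ x = 0) :
    ∫ x, ∫ a, ρ a * ⟪V (x - a), fderiv ℝ φ x (V (x - a))⟫ = 0 := by
  have hρc : HasCompactSupport ρ := hasCompactSupport_of_support_subset_ball hρδ
  have hρi : Integrable ρ := hρ.integrable_of_hasCompactSupport hρc
  -- the compact set carrying `|V|²`
  set K : Set E := tsupport φ with hK_def
  have hK : IsCompact K := hφ.hasCompactSupport
  set K' : Set E := K + closedBall (0 : E) δ with hK'_def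
  have hK' : IsCompact K' := hK.add (isCompact_closedBall 0 δ)
  set g : E → ℝ := K'.indicator fun y => ‖V y‖ ^ 2 with hg_def
  have hg : Integrable g :=
    (hV2.integrableOn_isCompact hK').integrable_indicator hK'.measurableSet
  have hg0 : ∀ y, 0 ≤ g y := fun y => Set.indicator_nonneg (fun _ _ => sq_nonneg _) y
  -- bound on `Dφ`
  obtain ⟨G, hG⟩ := (hφ.hasCompactSupport.fderiv (𝕜 := ℝ)).exists_bound_of_continuous
    (hφ.contDiff.continuous_fderiv (by simp))
  have hG0 : 0 ≤ G := (norm_nonneg _).trans (hG 0)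
  -- the integrand and its majorant on `E × E`
  set Φ : E × E → ℝ := fun p => ρ p.2 * ⟪V (p.1 - p.2), fderiv ℝ φ p.1 (V (p.1 - p.2))⟫
    with hΦ_def
  have hmaj : Integrable (fun p : E × E => (lsmul ℝ ℝ) (ρ p.2) (g (p.1 - p.2)))
      ((volume : Measure E).prod volume) :=
    hρi.convolution_integrand (lsmul ℝ ℝ) hg
  have hΦm : AEStronglyMeasurable Φ ((volume : Measure E).prod volume) := by
    have h1 : AEStronglyMeasurable (fun p : E × E => V (p.1 - p.2))
        ((volume : Measure E).prod volume) :=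
      hVm.comp_quasiMeasurePreserving (quasiMeasurePreserving_sub volume volume)
    have h2 : AEStronglyMeasurable (fun p : E × E => fderiv ℝ φ p.1)
        ((volume : Measure E).prod volume) :=
      ((hφ.contDiff.continuous_fderiv (by simp)).comp continuous_fst).aestronglyMeasurable
    have happ : Continuous (uncurry fun (L : E →L[ℝ] E) (v : E) => L v) :=
      isBoundedBilinearMap_apply.continuous
    have h3 : AEStronglyMeasurable (fun p : E × E => fderiv ℝ φ p.1 (V (p.1 - p.2)))
        ((volume : Measure E).prod volume) :=
      happ.comp_aestronglyMeasurable₂ h2 h1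
    exact ((hρ.comp continuous_snd).aestronglyMeasurable).mul (h1.inner h3)
  have hΦi : Integrable Φ ((volume : Measure E).prod volume) := by
    refine (hmaj.norm.const_mul G).mono' hΦm (Eventually.of_forall fun p => ?_)
    have hR : ‖(lsmul ℝ ℝ) (ρ p.2) (g (p.1 - p.2))‖ = ‖ρ p.2‖ * g (p.1 - p.2) := by
      rw [lsmul_apply, smul_eq_mul, norm_mul, Real.norm_of_nonneg (hg0 _)]
    rw [hR]
    by_cases hx : p.1 ∈ K
    · by_cases ha : p.2 ∈ support ρ
      · have haδ : ‖p.2‖ < δ := mem_ball_zero_iff.1 (hρδ ha)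
        have hmem : p.1 - p.2 ∈ K' := by
          rw [sub_eq_add_neg]
          exact Set.add_mem_add hx (by simpa using haδ.le)
        rw [hg_def, indicator_of_mem hmem]
        change ‖ρ p.2 * ⟪V (p.1 - p.2), fderiv ℝ φ p.1 (V (p.1 - p.2))⟫‖ ≤ _
        rw [norm_mul]
        have hin : ‖⟪V (p.1 - p.2), fderiv ℝ φ p.1 (V (p.1 - p.2))⟫‖ ≤
            G * ‖V (p.1 - p.2)‖ ^ 2 := by
          calc ‖⟪V (p.1 - p.2), fderiv ℝ φ p.1 (V (p.1 - p.2))⟫‖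
              ≤ ‖V (p.1 - p.2)‖ * ‖fderiv ℝ φ p.1 (V (p.1 - p.2))‖ := norm_inner_le_norm _ _
            _ ≤ ‖V (p.1 - p.2)‖ * (G * ‖V (p.1 - p.2)‖) := by
                gcongr
                exact (le_opNorm _ _).trans (mul_le_mul_of_nonneg_right (hG _) (norm_nonneg _))
            _ = G * ‖V (p.1 - p.2)‖ ^ 2 := by ring
        calc ‖ρ p.2‖ * ‖⟪V (p.1 - p.2), fderiv ℝ φ p.1 (V (p.1 - p.2))⟫‖
            ≤ ‖ρ p.2‖ * (G * ‖V (p.1 - p.2)‖ ^ 2) := by gcongr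
          _ = G * (‖ρ p.2‖ * ‖V (p.1 - p.2)‖ ^ 2) := by ring
      · have hρ0 : ρ p.2 = 0 := notMem_support.1 ha
        simp [hΦ_def, hρ0]
    · have hD : fderiv ℝ φ p.1 = 0 := fderiv_of_notMem_tsupport ℝ hx
      have : Φ p = 0 := by simp [hΦ_def, hD]
      rw [this, norm_zero]
      exact mul_nonneg hG0 (mul_nonneg (norm_nonneg _) (hg0 _))
  -- Fubini, then the inner integrals vanish
  have hsw := integral_integral_swap (μ := (volume : Measure E)) (ν := (volume : Measure E))
    (f := fun x a => ρ a * ⟪V (x - a), fderiv ℝ φ x (V (x - a))⟫) hΦi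
  calc ∫ x, ∫ a, ρ a * ⟪V (x - a), fderiv ℝ φ x (V (x - a))⟫
      = ∫ a, ∫ x, ρ a * ⟪V (x - a), fderiv ℝ φ x (V (x - a))⟫ := hsw
    _ = ∫ a, (0 : ℝ) := integral_congr_ae (Eventually.of_forall fun a => ?_)
    _ = 0 := integral_zero E ℝ
  dsimp only
  rw [integral_const_mul]
  by_cases ha : a ∈ support ρ
  · rw [integral_inner_translate_fderiv_apply_eq_zero hEuler hφ hdiv
      (mem_ball_zero_iff.1 (hρδ ha)).le, mul_zero]
  · rw [notMem_support.1 ha, zero_mul]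


/-! ### The Jensen defect of an average is positive semidefinite -/

open ProbabilityTheory Matrix in
/-- **PSD defect of an average (Jensen / covariance).** For finitely many real random variables
`v i` of finite variance under a probability measure `κ`, the matrix
`∫ vᵢ vⱼ dκ - (∫ vᵢ dκ)(∫ vⱼ dκ)` (the covariance matrix) is positive semidefinite:
`ξᵀ D ξ = Var_κ (∑ ξᵢ vᵢ) ≥ 0`. This is the pointwise sign `S̄ - V̄ ⊗ V̄ ⪰ 0` of the Reynolds defect
of ANY average of velocity fields (De Lellis–Székelyhidi: averages of solutions are
subsolutions). [folklore] -/
theorem posSemidef_covariance {α ι : Type*} [MeasurableSpace α] [Fintype ι] {κ : Measure α}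
    [IsProbabilityMeasure κ] {v : ι → α → ℝ} (hv : ∀ i, MemLp (v i) 2 κ) :
    (Matrix.of fun i j : ι =>
      ∫ a, v i a * v j a ∂κ - (∫ a, v i a ∂κ) * (∫ a, v j a ∂κ)).PosSemidef := by
  -- adapted from the wave-1 work file of stub_sinkSubsolutionCompletion (same session folder)
  have hcov : ∀ i j, (∫ a, v i a * v j a ∂κ - (∫ a, v i a ∂κ) * (∫ a, v j a ∂κ)) =
      cov[v i, v j; κ] := fun i j => by
    rw [covariance_eq_sub (hv i) (hv j)]
    rfl
  refine Matrix.PosSemidef.of_dotProduct_mulVec_nonneg ?_ ?_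
  · refine Matrix.IsHermitian.ext fun i j => ?_
    simp only [Matrix.of_apply, star_trivial]
    rw [mul_comm (∫ a, v i a ∂κ)]
    congr 1
    exact integral_congr_ae (Eventually.of_forall fun a => mul_comm _ _)
  · intro x
    have hquad : star x ⬝ᵥ (Matrix.of (fun i j : ι =>
        ∫ a, v i a * v j a ∂κ - (∫ a, v i a ∂κ) * (∫ a, v j a ∂κ)) *ᵥ x) =
        ∑ i, ∑ j, cov[fun a => x i * v i a, fun a => x j * v j a; κ] := by
      simp only [star_trivial, dotProduct, Matrix.mulVec, Matrix.of_apply, Finset.mul_sum, hcov,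
        covariance_const_mul_left, covariance_const_mul_right]
      refine Finset.sum_congr rfl fun i _ => Finset.sum_congr rfl fun j _ => ?_
      ring
    rw [hquad, ← covariance_fun_sum_fun_sum (fun i => (hv i).const_mul (x i))
      (fun j => (hv j).const_mul (x j)), covariance_self]
    · exact variance_nonneg _ _
    · exact (memLp_finsetSum Finset.univ fun i _ => (hv i).const_mul (x i)).aestronglyMeasurable
        |>.aemeasurable

end MollifiedEulerCone

end Literature.Analysis.FluidPDE

end
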